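import Literature.MathematicalPhysics.QuantumLattice.StrongCouplingBosonisation
import Literature.MathematicalPhysics.QuantumLattice.StaggeredDiracSingularSetNull
import Literature.MathematicalPhysics.QuantumLattice.StaggeredGaugeExpectationZeroCoupling
import Literature.MathematicalPhysics.QuantumLattice.StaggeredGaugePartitionFunctionSign
import Literature.MathematicalPhysics.QuantumLattice.GrassmannGaussianMoments
import Literature.MathematicalPhysics.QuantumLattice.GrassmannGaussianWordWick
import HarnessLib

/-!
# The determinant / propagator representation of the strongly coupled `U(N)` gauge theory with
# staggered fermions, and chiral long-range order in that representation

Salmhofer–Seiler, Commun. Math. Phys. **139** (1991) 395–432 [SalmhoferSeiler1991], §2: at `β = 0`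
the expectation (2.10) is `⟨f⟩ = Z⁻¹ ∫𝒟ψ𝒟ψ̄ 𝒟U e^{-S_F} f` with the Berezin integral `𝒟ψ𝒟ψ̄` (2.11)
and the product Haar measure `𝒟U` (2.12).  The tree carries this honestly as
`StrongCoupling.fermiExpect` (coefficientwise Haar integral of Grassmann-valued functions, then
`berezin`), and Cor. 4.9 at the gauge level as `StrongCoupling.chiralLRO_gauge_staggered` (module
`StrongCouplingBosonisation`).  "Integrating out the fermions" rewrites the same numbers as Haar
integrals of the fermion DETERMINANT times Wick contractions with the PROPAGATOR `D[U]⁻¹`: this is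
the form in which the cell's typed conjecture `Summit.Ventures.YMGap.Conjectures.SalmhoferSeilerSmallBeta`
(`Summits/Ventures/YMGap/Conjectures/StrongCouplingChiralLRO.lean`) states chiral long-range order,
with Mathlib's junk value `D⁻¹ = 0` on the singular set.  This file proves that the two
representations agree at `β = 0`, `m = 0` and transports Cor. 4.9:

* `fermiBoltzmann_torus_eq_grassmannExp_lexQuad` / `berezin_fermiBoltzmann_torus` —
  `∫dψ̄dψ e^{-S_F(U)} = ε · det(-D₀[U])`, `ε = (-1)^{n(n-1)/2}` (`StaggeredRP.orientationSign`),
  `D₀ = staggeredDirac (unitaryFundamentalRep) U 0` (periodic torus, phases (2.4));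
* `berezin_meson_meson_fermiBoltzmann_torus` — for `det D₀[U] ≠ 0`, the fermionic Wick rule
  (tree: `GrassmannAlgebra.berezin_grassmannExp_quadratic_mul_prod`) gives
  `∫dψ̄dψ ψ̄ψ(x) ψ̄ψ(y) e^{-S_F(U)} = ε det(-D₀[U]) · W_{xy}(D₀[U]⁻¹)`,
  `W_{xy}(G) = (tr G_{xx})(tr G_{yy}) - tr(G_{xy}G_{yx})` (`wick2`);
* `fermiZ_torus_eq_integral`, `fermiBracket_meson_meson_torus_eq_integral` — the Haar integrals; the
  second uses that `{det D₀[U] = 0}` is Haar-null (`StaggeredSingular.ae_det_staggeredDirac_ne_zero`,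
  module `StaggeredDiracSingularSetNull`), so the junk value of `Matrix.inv` is immaterial;
* **`detRep_twoPoint_eq_fermiExpect_re`** — for even `L ≥ 2` (then `n = N L^ν` is even and
  `det D₀[U]` is real):
  `(∫ Re det D₀ · Re W_{xy}(D₀⁻¹) d(wilsonWeight ρ 0)) / (∫ Re det D₀ d(wilsonWeight ρ 0)) = Re ⟨ψ̄ψ(x)ψ̄ψ(y)⟩`;
* **`chiralLRO_detRep`** — Cor. 4.9 in the determinant representation: for `1 ≤ N ≤ 4`, `ν ≥ 4`
  there are `c > 0`, `L₀` with
  `|Λ_L|⁻¹ ∑_x (∫ Re det D₀ Re W_{0x} d(wilsonWeight ρ 0)) / (∫ Re det D₀ d(wilsonWeight ρ 0)) ≥ c` for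
  all even `L ≥ L₀` — literally the `β = 0` slice of the typed conjecture `SalmhoferSeilerSmallBeta`
  (no order on the sites is needed in the statement; the Berezin conventions cancel).

Scope (honest framing): `β = 0`, `m = 0`, `G = U(N)` in the defining representation, finite even tori
with periodic links; nothing about `β > 0`, `SU(N)`, the continuum, or a mass gap.  No facts, no
`sorry`.

## References

* M. Salmhofer, E. Seiler, Commun. Math. Phys. 139 (1991) 395–432, §2 (2.9)–(2.12), Cor. 4.9
  [SalmhoferSeiler1991].
* F. A. Berezin, *The Method of Second Quantization* (1966), Ch. I §3 [Berezin1966] (Gaussian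
  Berezin integrals).
-/

noncomputable section

open MeasureTheory Matrix Complex Finset
open Literature.MathematicalPhysics.QuantumFieldTheory
open Literature.Probability.LatticeModels (TorusSite)
open scoped ComplexConjugate BigOperators

namespace Literature.MathematicalPhysics.QuantumLattice

namespace StrongCoupling

open GrassmannAlgebra StaggeredRP

/-! ## 1. Generic site sets: Gaussian Berezin integrals of two meson fields -/

section Generic

variable {Λ : Type*} [LinearOrder Λ] [Fintype Λ] {N : ℕ}

/-- The quadratic form `ψ̄ M ψ = ∑_{p,q} M_{pq} ψ̄_p ψ_q` of a matrix indexed by colour–site PAIRS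
`(x, a)` (the index type of `staggeredDirac`), in the fermion algebra of the lattice. [cite: SalmhoferSeiler1991, §2 (2.3)] -/
def lexQuad (M : Matrix (Λ × Fin N) (Λ × Fin N) ℂ) : FermiAlg Λ N :=
  ∑ p : Λ × Fin N, ∑ q : Λ × Fin N, M p q • (pair (toLex p) (toLex q) : FermiAlg Λ N)

/-- `ψ̄ M ψ` is the tree's `quadratic` of `M` reindexed lexicographically. [cite: SalmhoferSeiler1991, §2 (2.3)] -/
theorem lexQuad_eq_quadratic (M : Matrix (Λ × Fin N) (Λ × Fin N) ℂ) :
    lexQuad M = quadratic ℂ (M.submatrix (ofLex : CIdx Λ N ≃ Λ × Fin N) (ofLex : CIdx Λ N ≃ Λ × Fin N)) := by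
  rw [quadratic_eq_sum_pair, lexQuad, ← (toLex : Λ × Fin N ≃ CIdx Λ N).sum_comp]
  refine Finset.sum_congr rfl fun p _ => ?_
  rw [← (toLex : Λ × Fin N ≃ CIdx Λ N).sum_comp]
  rfl

/-- **`∫dψ̄dψ e^{ψ̄Mψ} = ε det M`**, `ε = (-1)^{n(n-1)/2}`. [cite: Berezin1966, Ch. I §3 Thm. 3.1] -/
theorem berezin_grassmannExp_lexQuad (M : Matrix (Λ × Fin N) (Λ × Fin N) ℂ) :
    berezin ℂ _ (grassmannExp (lexQuad M)) = orientationSign Λ N * M.det := by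
  rw [lexQuad_eq_quadratic, berezin_grassmannExp_quadratic_holds ℂ, orientationSign, Matrix.det_submatrix_equiv_self]

/-- The Wick contraction of `ψ̄ψ(x) ψ̄ψ(y)` with a propagator `G`:
`W_{xy}(G) = (tr_c G_{xx})(tr_c G_{yy}) - tr_c(G_{xy} G_{yx})`. [cite: SalmhoferSeiler1991, §2 (2.10)–(2.11)] -/
def wick2 (G : Matrix (Λ × Fin N) (Λ × Fin N) ℂ) (x y : Λ) : ℂ :=
  (∑ a : Fin N, G (x, a) (x, a)) * (∑ b : Fin N, G (y, b) (y, b)) -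
    ∑ a : Fin N, ∑ b : Fin N, G (x, a) (y, b) * G (y, b) (x, a)

omit [LinearOrder Λ] [Fintype Λ] in
/-- `W_{xy}` is even in the propagator. [cite: SalmhoferSeiler1991, §2 (2.10)–(2.11)] -/
theorem wick2_neg (G : Matrix (Λ × Fin N) (Λ × Fin N) ℂ) (x y : Λ) : wick2 (-G) x y = wick2 G x y := by
  simp only [wick2, Matrix.neg_apply, neg_mul_neg, Finset.sum_neg_distrib]

/-- **Fermionic Wick rule for two meson fields**: for `det M ≠ 0`,
`∫dψ̄dψ ψ̄ψ(x) ψ̄ψ(y) e^{ψ̄Mψ} = ε det M · W_{xy}(M⁻¹)`. [cite: SalmhoferSeiler1991, §2 (2.10)–(2.11)] -/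
theorem berezin_meson_meson_grassmannExp_lexQuad (M : Matrix (Λ × Fin N) (Λ × Fin N) ℂ) (hM : M.det ≠ 0)
    (x y : Λ) :
    berezin ℂ _ ((meson x * meson y : FermiAlg Λ N) * grassmannExp (lexQuad M)) =
      orientationSign Λ N * M.det * wick2 M⁻¹ x y := by
  classical
  set A : Matrix (CIdx Λ N) (CIdx Λ N) ℂ :=
    M.submatrix (ofLex : CIdx Λ N ≃ Λ × Fin N) (ofLex : CIdx Λ N ≃ Λ × Fin N) with hA
  have hAdet : A.det = M.det := Matrix.det_submatrix_equiv_self _ _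
  have hAunit : IsUnit A.det := by rw [hAdet]; exact Ne.isUnit hM
  have hAinv : ∀ p q : Λ × Fin N, A⁻¹ (toLex p) (toLex q) = M⁻¹ p q := by
    intro p q
    rw [hA, Matrix.inv_submatrix_equiv]
    rfl
  -- expand the two mesons into colour pairs and apply the Wick rule termwise
  have hterm : ∀ a b : Fin N,
      berezin ℂ _ ((pair (cidx x a) (cidx x a) * pair (cidx y b) (cidx y b) : FermiAlg Λ N) *
          grassmannExp (quadratic ℂ A)) =
        orientationSign Λ N * M.det * (M⁻¹ (x, a) (x, a) * M⁻¹ (y, b) (y, b) - M⁻¹ (x, a) (y, b) * M⁻¹ (y, b) (x, a)) := by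
    intro a b
    have hw := berezin_grassmannExp_quadratic_mul_prod ℂ A hAunit ![cidx x a, cidx y b] ![cidx x a, cidx y b]
    simp only [List.ofFn_succ, List.ofFn_zero, List.prod_cons, List.prod_nil, mul_one, Matrix.cons_val_zero,
      Matrix.cons_val_succ] at hw
    rw [mul_grassmannExp_quadratic_comm,
      show (pair (cidx x a) (cidx x a) * pair (cidx y b) (cidx y b) : FermiAlg Λ N) =
        psiBar ℂ (cidx x a) * psi ℂ (cidx x a) * (psiBar ℂ (cidx y b) * psi ℂ (cidx y b)) from rfl, hw,
      Matrix.det_fin_two, hAdet, orientationSign]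
    simp only [Matrix.of_apply, Matrix.cons_val_zero, Matrix.cons_val_one]
    rw [show cidx x a = toLex (x, a) from rfl, show cidx y b = toLex (y, b) from rfl, hAinv, hAinv, hAinv, hAinv]
  have hR : wick2 M⁻¹ x y =
      ∑ a : Fin N, ∑ b : Fin N, (M⁻¹ (x, a) (x, a) * M⁻¹ (y, b) (y, b) - M⁻¹ (x, a) (y, b) * M⁻¹ (y, b) (x, a)) := by
    rw [wick2, Finset.sum_mul_sum, ← Finset.sum_sub_distrib]
    refine Finset.sum_congr rfl fun a _ => ?_
    rw [← Finset.sum_sub_distrib]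
  rw [lexQuad_eq_quadratic, ← hA, meson, meson, Finset.sum_mul_sum, Finset.sum_mul, map_sum, hR, Finset.mul_sum]
  refine Finset.sum_congr rfl fun a _ => ?_
  rw [Finset.sum_mul, map_sum, Finset.mul_sum]
  refine Finset.sum_congr rfl fun b _ => ?_
  exact hterm a b

/-- The same for the weight `e^{ψ̄(-M)ψ}`, the propagator written as `M⁻¹` (`W` is even). [cite: SalmhoferSeiler1991, §2 (2.10)–(2.11)] -/
theorem berezin_meson_meson_grassmannExp_lexQuad_neg (M : Matrix (Λ × Fin N) (Λ × Fin N) ℂ) (hM : M.det ≠ 0)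
    (x y : Λ) :
    berezin ℂ _ ((meson x * meson y : FermiAlg Λ N) * grassmannExp (lexQuad (-M))) =
      orientationSign Λ N * (-M).det * wick2 M⁻¹ x y := by
  have hneg : (-M).det ≠ 0 := by
    rw [Matrix.det_neg]; exact mul_ne_zero (pow_ne_zero _ (neg_ne_zero.2 one_ne_zero)) hM
  have hinv : (-M)⁻¹ = -M⁻¹ := inv_neg_of_isUnit_det M (Ne.isUnit hM)
  rw [berezin_meson_meson_grassmannExp_lexQuad (-M) hneg, hinv, wick2_neg]

/-- A linear functional of a coefficientwise-integrable Grassmann-valued function is integrable. [cite: SalmhoferSeiler1991, §2 (2.9)] -/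
theorem integrable_apply_of_coeffIntegrable {κ Ω : Type*} [LinearOrder κ] [Fintype κ] [MeasurableSpace Ω]
    {μ : Measure Ω} (φ : GrassmannAlgebra ℂ κ →ₗ[ℂ] ℂ) {F : Ω → GrassmannAlgebra ℂ κ} (hF : CoeffIntegrable μ F) :
    Integrable (fun ω => φ (F ω)) μ := by
  have h : (fun ω => φ (F ω)) = fun ω => ∑ s : Finset κ, coord s (F ω) * φ (grassmannBasis ℂ κ s) := by
    funext ω
    conv_lhs => rw [eq_sum_coord_smul (F ω)]
    simp only [map_sum, map_smul, smul_eq_mul]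
  rw [h]
  exact integrable_finsetSum _ fun s _ => (hF s).mul_const _

end Generic

/-! ## 2. The torus at `β = 0`, `m = 0`: Berezin integrals against `e^{-S_F(U)}` -/

section Torus

open StaggeredSingular

variable {ν L N : ℕ} [NeZero L] [LinearOrder (TorusSite ν L)]

/-- The staggered signs `Γ_μ(x) = η_μ(x)` of (2.4), as the link-sign function of `StrongCoupling`. [cite: SalmhoferSeiler1991, §2 (2.4)] -/
abbrev stagSigns (ν L : ℕ) [NeZero L] : TorusSite ν L × Fin ν → ℂ := fun p => ((staggeredPhase p.1 p.2 : ℤ) : ℂ)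

/-- **`e^{-S_F(U)} = exp(ψ̄(-D₀[U])ψ)` at zero mass**, `D₀` the tree's staggered Dirac operator
(from `fermiBoltzmann_torus_eq_staggeredDirac`). [cite: SalmhoferSeiler1991, §2 (2.3)] -/
theorem fermiBoltzmann_torus_eq_grassmannExp_lexQuad (U : GaugeConfig ν L (OneLink.UN N)) :
    fermiBoltzmann (torusLinks ν L) (stagSigns ν L) ((0 : ℝ) : ℂ) U = grassmannExp (lexQuad (-D0 U)) := by
  have h := fermiBoltzmann_torus_eq_staggeredDirac (N := N) U 0
  rw [neg_zero] at h
  exact h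

/-- **`∫dψ̄dψ e^{-S_F(U)} = ε det(-D₀[U])`.** [cite: SalmhoferSeiler1991, §2 (2.11)] -/
theorem berezin_fermiBoltzmann_torus (U : GaugeConfig ν L (OneLink.UN N)) :
    berezin ℂ _ (fermiBoltzmann (torusLinks ν L) (stagSigns ν L) ((0 : ℝ) : ℂ) U) =
      orientationSign (TorusSite ν L) N * (-D0 U).det := by
  rw [fermiBoltzmann_torus_eq_grassmannExp_lexQuad]
  -- `convert`: the generic lemma carries the order-derived `DecidableEq` of the sites inside `det`
  convert berezin_grassmannExp_lexQuad (N := N) (-D0 U) using 3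

/-- **Wick's rule for `ψ̄ψ(x) ψ̄ψ(y)` against `e^{-S_F(U)}`**, for `det D₀[U] ≠ 0`:
`∫dψ̄dψ ψ̄ψ(x)ψ̄ψ(y) e^{-S_F(U)} = ε det(-D₀[U]) W_{xy}(D₀[U]⁻¹)`. [cite: SalmhoferSeiler1991, §2 (2.10)–(2.11)] -/
theorem berezin_meson_meson_fermiBoltzmann_torus (U : GaugeConfig ν L (OneLink.UN N)) (hU : (D0 U).det ≠ 0)
    (x y : TorusSite ν L) :
    berezin ℂ _ ((meson x * meson y : FermiAlg (TorusSite ν L) N) *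
        fermiBoltzmann (torusLinks ν L) (stagSigns ν L) ((0 : ℝ) : ℂ) U) =
      orientationSign (TorusSite ν L) N * (-D0 U).det * wick2 (D0 U)⁻¹ x y := by
  rw [fermiBoltzmann_torus_eq_grassmannExp_lexQuad]
  -- `convert`: instance bookkeeping as in `berezin_fermiBoltzmann_torus`
  have hU' := hU
  convert berezin_meson_meson_grassmannExp_lexQuad_neg (N := N) (D0 U) (by convert hU' using 2) x y

/-- **The partition function as a determinant integral**: `Z = ε ∫ det(-D₀[U]) 𝒟U`. [cite: SalmhoferSeiler1991, §2 (2.9), (2.11)] -/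
theorem fermiZ_torus_eq_integral (hL : 1 < L) :
    fermiZ (N := N) (torusLinks ν L) (stagSigns ν L) ((0 : ℝ) : ℂ) =
      orientationSign (TorusSite ν L) N *
        ∫ U, (-D0 U).det ∂(gaugeMeasure N (TorusSite ν L × Fin ν)) := by
  rw [fermiZ, fermiBracket, apply_cintegral (berezin ℂ _)
    (coeffIntegrable_mul_fermiBoltzmann _ (torusLinks_ne hL) _ _ (CoeffContinuous.const _)), ← integral_const_mul]
  refine integral_congr_ae (ae_of_all _ fun U => ?_)
  show berezin ℂ _ (1 * _) = _
  rw [one_mul, berezin_fermiBoltzmann_torus]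

/-- **The two-meson numerator as a determinant × Wick integral**:
`∫𝒟ψ𝒟ψ̄𝒟U e^{-S} ψ̄ψ(x)ψ̄ψ(y) = ε ∫ det(-D₀[U]) W_{xy}(D₀[U]⁻¹) 𝒟U` — the singular `U` form a
Haar-null set, so the junk value of `Matrix.inv` there is immaterial. [cite: SalmhoferSeiler1991, §2 (2.10)–(2.12)] -/
theorem fermiBracket_meson_meson_torus_eq_integral [NeZero ν] (hL : 1 < L) (x y : TorusSite ν L) :
    fermiBracket (torusLinks ν L) (stagSigns ν L) ((0 : ℝ) : ℂ)
        (fun _ => (meson x * meson y : FermiAlg (TorusSite ν L) N)) =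
      orientationSign (TorusSite ν L) N *
        ∫ U, (-D0 U).det * wick2 (D0 U)⁻¹ x y ∂(gaugeMeasure N (TorusSite ν L × Fin ν)) := by
  rw [fermiBracket, apply_cintegral (berezin ℂ _)
    (coeffIntegrable_mul_fermiBoltzmann _ (torusLinks_ne hL) _ _ (CoeffContinuous.const _)), ← integral_const_mul]
  refine integral_congr_ae ?_
  have hae := ae_det_staggeredDirac_ne_zero (ν := ν) (L := L) (N := N)
  filter_upwards [hae] with U hU
  rw [berezin_meson_meson_fermiBoltzmann_torus U hU, mul_assoc]

/-! ## 3. Reality and the real-part (determinant) representation -/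

omit [LinearOrder (TorusSite ν L)] in
/-- `n = N L^ν` is even on an even torus with `ν ≥ 1`. [cite: SalmhoferSeiler1991, §2 (2.1)] -/
theorem even_card_ci [NeZero ν] (hL : Even L) : Even (Fintype.card (TorusSite ν L × Fin N)) := by
  have h : Fintype.card (TorusSite ν L × Fin N) = L ^ ν * N := by
    simp [Fintype.card_prod, Fintype.card_pi, ZMod.card, Finset.prod_const, Finset.card_univ]
  rw [h]
  exact (Nat.even_pow.2 ⟨hL, NeZero.ne ν⟩).mul_right N

omit [LinearOrder (TorusSite ν L)] in
/-- On an even torus `det(-D₀[U]) = det D₀[U]`. [cite: SalmhoferSeiler1991, §2 (2.11)] -/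
theorem det_neg_D0 [NeZero ν] (hL : Even L) (U : GaugeConfig ν L (OneLink.UN N)) : (-D0 U).det = (D0 U).det := by
  rw [Matrix.det_neg, (even_card_ci (N := N) hL).neg_one_pow, one_mul]

omit [LinearOrder (TorusSite ν L)] in
/-- **`det D₀[U]` is real** on an even torus: `D₀` is anti-Hermitian (`staggeredDirac_antihermitian_massless_holds`)
and has even size. [cite: SalmhoferSeiler1991, §2 (2.11)] -/
theorem conj_det_D0 [NeZero ν] (hL : Even L) (U : GaugeConfig ν L (OneLink.UN N)) : conj (D0 U).det = (D0 U).det := by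
  have hanti : (D0 U)ᴴ = -D0 U :=
    staggeredDirac_antihermitian_massless_holds (d := ν) (L := L) (unitaryFundamentalRep (Fin N) ℂ) (fun g => g.2) U
  have h := Matrix.det_conjTranspose (D0 U)
  rw [hanti, det_neg_D0 hL U, Complex.star_def] at h
  exact h.symm

omit [LinearOrder (TorusSite ν L)] in
/-- The imaginary part of `det D₀[U]` vanishes on an even torus. [cite: SalmhoferSeiler1991, §2 (2.11)] -/
theorem det_D0_im [NeZero ν] (hL : Even L) (U : GaugeConfig ν L (OneLink.UN N)) : ((D0 U).det).im = 0 :=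
  Complex.conj_eq_iff_im.1 (conj_det_D0 hL U)

omit [LinearOrder (TorusSite ν L)] in
/-- `det D₀[U] = Re det D₀[U]` as a complex number. [cite: SalmhoferSeiler1991, §2 (2.11)] -/
theorem det_D0_eq_ofReal_re [NeZero ν] (hL : Even L) (U : GaugeConfig ν L (OneLink.UN N)) :
    (D0 U).det = (((D0 U).det).re : ℂ) :=
  (Complex.conj_eq_iff_re.1 (conj_det_D0 hL U)).symm

/-- **The determinant representation of the two-meson function at `β = 0`, `m = 0`** (even `L ≥ 2`,
`ν ≥ 1`): with `D₀ = D₀[U]` the massless staggered Dirac operator and `W_{xy}` the Wick contraction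
with the propagator `D₀⁻¹` (junk `0` on the Haar-null singular set),
`(∫ Re det D₀ · Re W_{xy}(D₀⁻¹) d(wilsonWeight ρ 0)) / (∫ Re det D₀ d(wilsonWeight ρ 0)) = Re ⟨ψ̄ψ(x) ψ̄ψ(y)⟩_{S,Λ}`. [cite: SalmhoferSeiler1991, §2 (2.10)–(2.12)] -/
theorem detRep_twoPoint_eq_fermiExpect_re [NeZero ν] (hL : Even L) (hL1 : 1 < L) (x y : TorusSite ν L) :
    (∫ U, ((D0 U).det).re * (wick2 (D0 U)⁻¹ x y).re
        ∂(wilsonWeight (d := ν) (L := L) (unitaryFundamentalRep (Fin N) ℂ) 0)) /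
      (∫ U, ((D0 U).det).re ∂(wilsonWeight (d := ν) (L := L) (unitaryFundamentalRep (Fin N) ℂ) 0)) =
    (fermiExpect (torusLinks ν L) (stagSigns ν L) ((0 : ℝ) : ℂ)
        (fun _ => (meson x * meson y : FermiAlg (TorusSite ν L) N))).re := by
  rw [wilsonWeight_zero]
  set μ : Measure (GaugeConfig ν L (OneLink.UN N)) := Measure.pi fun _ => haarProbability (OneLink.UN N) with hμ
  have hgm : gaugeMeasure N (TorusSite ν L × Fin ν) = μ := rfl
  -- the complex integrand `f = det D₀ · W` and its a.e. identification with the Berezin integrand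
  set f : GaugeConfig ν L (OneLink.UN N) → ℂ := fun U => (D0 U).det * wick2 (D0 U)⁻¹ x y with hf
  set s : ℂ := orientationSign (TorusSite ν L) N with hs
  have hs0 : s ≠ 0 := orientationSign_ne_zero
  have hss : s * s = 1 := orientationSign_mul_self
  have hB : ∀ U, (D0 U).det ≠ 0 →
      f U = s * berezin ℂ _ ((meson x * meson y : FermiAlg (TorusSite ν L) N) *
        fermiBoltzmann (torusLinks ν L) (stagSigns ν L) ((0 : ℝ) : ℂ) U) := by
    intro U hU
    rw [berezin_meson_meson_fermiBoltzmann_torus U hU, det_neg_D0 hL, ← hs, ← mul_assoc, ← mul_assoc, hss, one_mul]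
  have hint : Integrable (fun U => berezin ℂ _ ((meson x * meson y : FermiAlg (TorusSite ν L) N) *
      fermiBoltzmann (torusLinks ν L) (stagSigns ν L) ((0 : ℝ) : ℂ) U)) μ := by
    rw [← hgm]
    exact integrable_apply_of_coeffIntegrable (berezin ℂ _)
      (coeffIntegrable_mul_fermiBoltzmann _ (torusLinks_ne hL1) _ _ (CoeffContinuous.const _))
  have hae : f =ᵐ[μ] fun U => s * berezin ℂ _ ((meson x * meson y : FermiAlg (TorusSite ν L) N) *
      fermiBoltzmann (torusLinks ν L) (stagSigns ν L) ((0 : ℝ) : ℂ) U) := by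
    have := ae_det_staggeredDirac_ne_zero (ν := ν) (L := L) (N := N)
    filter_upwards [this] with U hU using hB U hU
  have hfint : Integrable f μ := (hint.const_mul s).congr hae.symm
  -- numerator: `∫ Re det · Re W = Re ∫ f`
  have hnum : ∫ U, ((D0 U).det).re * (wick2 (D0 U)⁻¹ x y).re ∂μ = (∫ U, f U ∂μ).re := by
    have h1 := Complex.reCLM.integral_comp_comm hfint
    simp only [Complex.reCLM_apply] at h1
    rw [← h1]
    refine integral_congr_ae (ae_of_all _ fun U => ?_)
    simp only [hf, Complex.mul_re, det_D0_im hL U, zero_mul, sub_zero]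
  -- denominator: `∫ Re det = ∫ det` (real)
  have hden : ∫ U, (D0 U).det ∂μ = ((∫ U, ((D0 U).det).re ∂μ : ℝ) : ℂ) := by
    rw [← integral_complex_ofReal]
    exact integral_congr_ae (ae_of_all _ fun U => det_D0_eq_ofReal_re hL U)
  -- the Berezin side
  have hZ : fermiZ (N := N) (torusLinks ν L) (stagSigns ν L) ((0 : ℝ) : ℂ) = s * ∫ U, (D0 U).det ∂μ := by
    rw [fermiZ_torus_eq_integral hL1, hgm]
    congr 1
    exact integral_congr_ae (ae_of_all _ fun U => by simp only [det_neg_D0 hL U])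
  have hBr : fermiBracket (torusLinks ν L) (stagSigns ν L) ((0 : ℝ) : ℂ)
      (fun _ => (meson x * meson y : FermiAlg (TorusSite ν L) N)) = s * ∫ U, f U ∂μ := by
    rw [fermiBracket_meson_meson_torus_eq_integral hL1, hgm]
    congr 1
    exact integral_congr_ae (ae_of_all _ fun U => by simp only [hf, det_neg_D0 hL U])
  rw [fermiExpect, hBr, hZ, mul_div_mul_left _ _ hs0, hnum, hden, Complex.div_ofReal_re]

/-! ## 4. Chiral long-range order in the determinant representation (`β = 0` slice of the conjecture) -/

omit [NeZero L] in
/-- Scaling both meson fields. [cite: SalmhoferSeiler1991, §2 (2.21)] -/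
theorem smul_meson_mul_smul_meson (c : ℂ) (x y : TorusSite ν L) :
    ((c • meson x) * (c • meson y) : FermiAlg (TorusSite ν L) N) = (c * c) • (meson x * meson y) := by
  rw [smul_mul_smul_comm]

end Torus

section Slice

open StaggeredSingular

variable {ν N : ℕ}

/-- **Cor. 4.9 in the determinant representation = the `β = 0` slice of the typed conjecture
`SalmhoferSeilerSmallBeta`**: for `1 ≤ N ≤ 4` and `ν ≥ 4` there are `c > 0` and `L₀` such that for
every even `L ≥ L₀`,
`|Λ_L|⁻¹ ∑_x (∫ Re det D₀[U] · Re W_{0x}(D₀[U]⁻¹) d(wilsonWeight ρ 0)) / (∫ Re det D₀[U] d(wilsonWeight ρ 0)) ≥ c`,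
`D₀[U] = staggeredDirac unitaryFundamentalRep U 0` on `(ℤ/Lℤ)^ν` (periodic), `W_{0x}` the Wick
contraction of `ψ̄ψ(0)ψ̄ψ(x)` with `D₀[U]⁻¹`.  From `chiralLRO_gauge_staggered` (Salmhofer–Seiler
Cor. 4.9 at the gauge level) through `detRep_twoPoint_eq_fermiExpect_re`. [cite: SalmhoferSeiler1991, Cor. 4.9 with (2.10)–(2.11) and (4.41)–(4.43)] -/
theorem chiralLRO_detRep (hN1 : 1 ≤ N) (hN4 : N ≤ 4) (hν : 4 ≤ ν) :
    ∃ c : ℝ, 0 < c ∧ ∃ L₀ : ℕ, ∀ (L : ℕ) [NeZero L], Even L → L₀ ≤ L →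
      c ≤ ((L : ℝ) ^ ν)⁻¹ * ∑ x : TorusSite ν L,
        (∫ U, ((staggeredDirac (unitaryFundamentalRep (Fin N) ℂ) U 0).det).re *
              (let G := (staggeredDirac (unitaryFundamentalRep (Fin N) ℂ) U 0)⁻¹
               ((∑ a : Fin N, G (0, a) (0, a)) * (∑ b : Fin N, G (x, b) (x, b)) -
                  ∑ a : Fin N, ∑ b : Fin N, G (0, a) (x, b) * G (x, b) (0, a)).re)
            ∂(wilsonWeight (d := ν) (L := L) (unitaryFundamentalRep (Fin N) ℂ) 0)) /
          (∫ U, ((staggeredDirac (unitaryFundamentalRep (Fin N) ℂ) U 0).det).re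
            ∂(wilsonWeight (d := ν) (L := L) (unitaryFundamentalRep (Fin N) ℂ) 0)) := by
  haveI : NeZero ν := ⟨by omega⟩
  obtain ⟨c, hc, L₀, h⟩ := chiralLRO_gauge_staggered (ν := ν) hN1 hN4 hν
  refine ⟨c, hc, max L₀ 2, fun L _ hE hL => ?_⟩
  classical
  -- an arbitrary linear order of the sites (the statement does not depend on it)
  letI : LinearOrder (TorusSite ν L) :=
    LinearOrder.lift' (Fintype.equivFin (TorusSite ν L)) (Fintype.equivFin (TorusSite ν L)).injective
  have hL1 : 1 < L := lt_of_lt_of_le (by norm_num) ((le_max_right L₀ 2).trans hL)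
  have key := h L hE ((le_max_left L₀ 2).trans hL)
  -- rewrite the gauge-level expectation through the determinant representation
  have hcard : (Fintype.card (TorusSite ν L) : ℝ) = (L : ℝ) ^ ν := by
    rw [Fintype.card_fun, ZMod.card, Fintype.card_fin, Nat.cast_pow]
  have h2N : (2 * N : ℂ) ≠ 0 := by exact_mod_cast (by omega : 2 * N ≠ 0)
  have hterm : ∀ x : TorusSite ν L,
      (fermiExpect (torusLinks ν L) (fun p => ((staggeredPhase p.1 p.2 : ℤ) : ℂ)) ((0 : ℝ) : ℂ)
          (fun _ => (((2 * N : ℂ)⁻¹ • meson 0) * ((2 * N : ℂ)⁻¹ • meson x) : FermiAlg (TorusSite ν L) N))).re =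
        ((2 * N : ℝ)⁻¹ * (2 * N : ℝ)⁻¹) *
          ((∫ U, ((D0 U).det).re * (wick2 (D0 U)⁻¹ 0 x).re
              ∂(wilsonWeight (d := ν) (L := L) (unitaryFundamentalRep (Fin N) ℂ) 0)) /
            (∫ U, ((D0 U).det).re ∂(wilsonWeight (d := ν) (L := L) (unitaryFundamentalRep (Fin N) ℂ) 0))) := by
    intro x
    rw [detRep_twoPoint_eq_fermiExpect_re hE hL1, smul_meson_mul_smul_meson, fermiExpect, fermiExpect,
      fermiBracket_const_smul _ (torusLinks_ne hL1), mul_div_assoc,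
      show ((2 * N : ℂ)⁻¹ * (2 * N : ℂ)⁻¹) = (((2 * N : ℝ)⁻¹ * (2 * N : ℝ)⁻¹ : ℝ) : ℂ) by push_cast; ring,
      Complex.re_ofReal_mul]
  simp_rw [hterm] at key
  rw [← Finset.mul_sum, hcard, ← mul_assoc, mul_comm (((L : ℝ) ^ ν)⁻¹), mul_assoc] at key
  -- `c ≤ (2N)⁻² · X` with `(2N)⁻² ≤ 1` and `X ≥ 0`... rather: `X ≥ (2N)² c ≥ c`
  have hNpos : (0 : ℝ) < 2 * N := by exact_mod_cast (by omega : 0 < 2 * N)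
  have hq : 0 < (2 * N : ℝ)⁻¹ * (2 * N : ℝ)⁻¹ := mul_pos (inv_pos.2 hNpos) (inv_pos.2 hNpos)
  have hq1 : (2 * N : ℝ)⁻¹ * (2 * N : ℝ)⁻¹ ≤ 1 := by
    have h1 : (1 : ℝ) ≤ 2 * N := by exact_mod_cast (by omega : 1 ≤ 2 * N)
    have : (2 * N : ℝ)⁻¹ ≤ 1 := inv_le_one_of_one_le₀ h1
    calc (2 * N : ℝ)⁻¹ * (2 * N : ℝ)⁻¹ ≤ 1 * 1 := mul_le_mul this this (inv_pos.2 hNpos).le zero_le_one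
      _ = 1 := one_mul 1
  set X := ((L : ℝ) ^ ν)⁻¹ * ∑ x : TorusSite ν L,
    (∫ U, ((D0 U).det).re * (wick2 (D0 U)⁻¹ 0 x).re
        ∂(wilsonWeight (d := ν) (L := L) (unitaryFundamentalRep (Fin N) ℂ) 0)) /
      (∫ U, ((D0 U).det).re ∂(wilsonWeight (d := ν) (L := L) (unitaryFundamentalRep (Fin N) ℂ) 0)) with hX
  have hcX : c ≤ X := by
    have hXpos : 0 < X := by
      by_contra hneg
      push Not at hneg
      have : (2 * N : ℝ)⁻¹ * (2 * N : ℝ)⁻¹ * X ≤ 0 := mul_nonpos_of_nonneg_of_nonpos hq.le hneg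
      linarith
    calc c ≤ (2 * N : ℝ)⁻¹ * (2 * N : ℝ)⁻¹ * X := key
      _ ≤ 1 * X := mul_le_mul_of_nonneg_right hq1 hXpos.le
      _ = X := one_mul X
  exact hcX

end Slice

end StrongCoupling

end Literature.MathematicalPhysics.QuantumLattice

end
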